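import Literature.Topology.FourManifolds.MMSWRasmussenFacts
import Literature.Topology.FourManifolds.DehnSurgery
import Literature.Geometry.Manifold.OpenEmbeddingCriterion
import Summits.SmoothPoincare4.SmoothPoincare4.Theses.DottedCircleRasmussen
import Summits.SmoothPoincare4.SmoothPoincare4.Theorems.DottedCircleRasmussenDcrGapHelperFriendsCarrierTkAux7

/-!
# Helper `helper_friendsCarrier_Vk_rescale` (piece 14 of the registered helper `helper_friendsCarrier_Vk`,
line `mk_friends`, skeleton v7) for crux `DcrGap`
(item stmt-SmoothPoincare4-16128, route route-SmoothPoincare4-DottedCircleRasmussen)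

**Fibre rescaling of the surgery presentation.**  In the hypothesis block of `helper_friendsCarrier_Vk` the
`3`-manifold `Y` is presented as the model boundary `M_k = ∂D_k` surgered along the model knot `K₁`: a chart
`jM` of `M_k ∖ K₁` (smooth on an open `W`, inverse `ψ`), a solid torus `jB : D̊² × 𝕊¹ ↪ Y`, and the gluing
relation `jM (νK (u, t • v)) = jB (t • u, v)` (`0 < t < 1`) through a tube `νK : 𝕊¹ × ℝ² → M_k` of `K₁`, the
dual knot being `μ₁ = jB (0, ·)`.  The normal form of the slice disc produced for the collar
(`helper_friendsCarrier_Vk_partB` of the split) matches the flow-out of `νK` only after SHRINKING THE FIBRES,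
`ν_c (u, w) = νK (u, c • w)` with `0 < c ≤ 1` (exactly as the `k = 0` template
`SliceDiscConicalTube.lean` matches the cone over the rescaled tube `ν.scale c` and re-presents the
`0`-surgery with it).  This file proves that the SAME `Y`, with the SAME chart `jM`, `W`, `ψ` and the SAME
dual knot `μ₁`, is presented through `ν_c` by the rescaled solid torus `jB' (p, v) = jB (c • p, v)`:

* `jB'` is a smooth embedding with open range (the tree's reparametrisation lemma
  `Literature.Geometry.Manifold.isSmoothEmbedding_comp_of_inverse`: `(p, v) ↦ (c • p, v)` is a smooth
  injective open self-map of the open solid torus with smooth inverse on its range);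
* `ν_c` is again a `C^∞` injective immersion into `M_k` with zero section `K₁` (its differential is
  `dνK ∘ d(id × c •)`, both injective);
* the cover `jM(M_k ∖ K₁) ∪ jB'(D̊² × 𝕊¹) = Y` (a point `jB (p, v)` with `p ≠ 0` is `jM (νK (p̂, ‖p‖ v))`) and
  the gluing relation for `(ν_c, jB')` (the radius `t` of `jB'` is the radius `c t` of `jB`);
* `μ₁ v = jB' (0, v)`.

No definitions, no named facts, no `sorry`.

## References

* D. Rolfsen, *Knots and Links* (1976), §9.F (the surgery solid torus and its meridian discs). [Rolfsen1976]
* J. M. Lee, *Introduction to Smooth Manifolds*, 2nd ed. (2013), Prop. 5.2. [LeeSmoothManifolds2013]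
-/

-- the prescribed namespace `Summit.<P>.<Sub>.…` duplicates `SmoothPoincare4` (P = Sub)
set_option linter.dupNamespace false
set_option linter.style.longLine false

noncomputable section

open scoped Manifold ContDiff Topology
open Function Set Metric TopologicalSpace
open Literature.Topology.FourManifolds Literature.Topology.FourManifolds.MMSW
open Literature.AlgebraicTopology.Homotopy.HopfFibration

namespace Summit.SmoothPoincare4.SmoothPoincare4.Theorems.DcrGap.MkFriends

namespace FriendsCarrierVk

/-- **The fibre-rescaled tube is again a tube**: for a `C^∞` injective immersion `νK : 𝕊¹ × ℝ² → M_k` with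
zero section `K₁` and `c ≠ 0`, the map `ν_c (u, w) = νK (u, c • w)` is a `C^∞` injective immersion into
`M_k` with zero section `K₁`. [cite: HirschDT1976, §4.5] -/
theorem rescaleTube {k : ℕ} {K₁ : (sphere (0 : EuclideanSpace ℝ (Fin 2)) 1) → EuclideanSpace ℝ (Fin 4)}
    {νK : (sphere (0 : EuclideanSpace ℝ (Fin 2)) 1) × EuclideanSpace ℝ (Fin 2) → EuclideanSpace ℝ (Fin 4)}
    (hν : ContMDiff ((𝓡 1).prod 𝓘(ℝ, EuclideanSpace ℝ (Fin 2))) 𝓘(ℝ, EuclideanSpace ℝ (Fin 4)) ∞ νK)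
    (hinj : Injective νK)
    (himm : ∀ p, Injective (mfderiv ((𝓡 1).prod 𝓘(ℝ, EuclideanSpace ℝ (Fin 2))) 𝓘(ℝ, EuclideanSpace ℝ (Fin 4)) νK p))
    (hmem : ∀ p, νK p ∈ modelBoundary k) (hK : ∀ u : (sphere (0 : EuclideanSpace ℝ (Fin 2)) 1), νK (u, 0) = K₁ u)
    {c : ℝ} (hc : c ≠ 0) :
    ContMDiff ((𝓡 1).prod 𝓘(ℝ, EuclideanSpace ℝ (Fin 2))) 𝓘(ℝ, EuclideanSpace ℝ (Fin 4)) ∞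
        (fun q : (sphere (0 : EuclideanSpace ℝ (Fin 2)) 1) × EuclideanSpace ℝ (Fin 2) => νK (q.1, c • q.2)) ∧
      Injective (fun q : (sphere (0 : EuclideanSpace ℝ (Fin 2)) 1) × EuclideanSpace ℝ (Fin 2) => νK (q.1, c • q.2)) ∧
      (∀ p, Injective (mfderiv ((𝓡 1).prod 𝓘(ℝ, EuclideanSpace ℝ (Fin 2))) 𝓘(ℝ, EuclideanSpace ℝ (Fin 4))
        (fun q : (sphere (0 : EuclideanSpace ℝ (Fin 2)) 1) × EuclideanSpace ℝ (Fin 2) => νK (q.1, c • q.2)) p)) ∧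
      (∀ p, (fun q : (sphere (0 : EuclideanSpace ℝ (Fin 2)) 1) × EuclideanSpace ℝ (Fin 2) => νK (q.1, c • q.2)) p ∈ modelBoundary k) ∧
      (∀ u : (sphere (0 : EuclideanSpace ℝ (Fin 2)) 1),
        (fun q : (sphere (0 : EuclideanSpace ℝ (Fin 2)) 1) × EuclideanSpace ℝ (Fin 2) => νK (q.1, c • q.2)) (u, 0) = K₁ u) := by
  set F : (sphere (0 : EuclideanSpace ℝ (Fin 2)) 1) × EuclideanSpace ℝ (Fin 2) →
      (sphere (0 : EuclideanSpace ℝ (Fin 2)) 1) × EuclideanSpace ℝ (Fin 2) := fun q => (q.1, c • q.2) with hF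
  set G : (sphere (0 : EuclideanSpace ℝ (Fin 2)) 1) × EuclideanSpace ℝ (Fin 2) →
      (sphere (0 : EuclideanSpace ℝ (Fin 2)) 1) × EuclideanSpace ℝ (Fin 2) := fun q => (q.1, c⁻¹ • q.2) with hG
  have hn : (∞ : ℕ∞ω) ≠ 0 := by simp
  have hGF : ∀ q, G (F q) = q := fun q => by
    simp only [hF, hG, smul_smul, inv_mul_cancel₀ hc, one_smul]
  have hFs : ContMDiff ((𝓡 1).prod 𝓘(ℝ, EuclideanSpace ℝ (Fin 2))) ((𝓡 1).prod 𝓘(ℝ, EuclideanSpace ℝ (Fin 2))) ∞ F :=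
    contMDiff_fst.prodMk ((contDiff_const_smul c).contMDiff.comp contMDiff_snd)
  have hGs : ContMDiff ((𝓡 1).prod 𝓘(ℝ, EuclideanSpace ℝ (Fin 2))) ((𝓡 1).prod 𝓘(ℝ, EuclideanSpace ℝ (Fin 2))) ∞ G :=
    contMDiff_fst.prodMk ((contDiff_const_smul c⁻¹).contMDiff.comp contMDiff_snd)
  have hcomp : (fun q : (sphere (0 : EuclideanSpace ℝ (Fin 2)) 1) × EuclideanSpace ℝ (Fin 2) => νK (q.1, c • q.2)) = νK ∘ F := rfl
  rw [hcomp]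
  refine ⟨hν.comp hFs, hinj.comp (LeftInverse.injective hGF), fun p => ?_, fun p => hmem _, fun u => ?_⟩
  · have hFd : MDifferentiableAt ((𝓡 1).prod 𝓘(ℝ, EuclideanSpace ℝ (Fin 2))) ((𝓡 1).prod 𝓘(ℝ, EuclideanSpace ℝ (Fin 2)))
        F p := hFs.mdifferentiableAt hn
    have hGd : MDifferentiableAt ((𝓡 1).prod 𝓘(ℝ, EuclideanSpace ℝ (Fin 2))) ((𝓡 1).prod 𝓘(ℝ, EuclideanSpace ℝ (Fin 2)))
        G (F p) := hGs.mdifferentiableAt hn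
    have hνd : MDifferentiableAt ((𝓡 1).prod 𝓘(ℝ, EuclideanSpace ℝ (Fin 2))) 𝓘(ℝ, EuclideanSpace ℝ (Fin 4)) νK (F p) :=
      hν.mdifferentiableAt hn
    rw [mfderiv_comp p hνd hFd]
    have hid : (mfderiv ((𝓡 1).prod 𝓘(ℝ, EuclideanSpace ℝ (Fin 2))) ((𝓡 1).prod 𝓘(ℝ, EuclideanSpace ℝ (Fin 2))) G (F p)).comp
        (mfderiv ((𝓡 1).prod 𝓘(ℝ, EuclideanSpace ℝ (Fin 2))) ((𝓡 1).prod 𝓘(ℝ, EuclideanSpace ℝ (Fin 2))) F p) =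
        ContinuousLinearMap.id ℝ _ := by
      rw [← mfderiv_comp p hGd hFd, show G ∘ F = id from funext hGF, mfderiv_id]
    have hFinj : Injective (mfderiv ((𝓡 1).prod 𝓘(ℝ, EuclideanSpace ℝ (Fin 2))) ((𝓡 1).prod 𝓘(ℝ, EuclideanSpace ℝ (Fin 2))) F p) :=
      FriendsTk.injective_of_leftInverse_clm fun v => by
        have := DFunLike.congr_fun hid v
        exact this
    exact (himm (F p)).comp hFinj
  · show νK (u, c • (0 : EuclideanSpace ℝ (Fin 2))) = K₁ u
    rw [smul_zero]; exact hK u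

/-- A point of `ℝ² × 𝕊¹` with first coordinate of norm `< 1` scaled by `0 < c ≤ 1` stays in the open solid
torus. [folklore] -/
theorem smul_mem_solidTorus {c : ℝ} (hc : 0 < c) (hc1 : c ≤ 1) (b : ↥solidTorus) :
    ((c • (b : EuclideanSpace ℝ (Fin 2) × (sphere (0 : EuclideanSpace ℝ (Fin 2)) 1)).1,
      (b : EuclideanSpace ℝ (Fin 2) × (sphere (0 : EuclideanSpace ℝ (Fin 2)) 1)).2) :
        EuclideanSpace ℝ (Fin 2) × (sphere (0 : EuclideanSpace ℝ (Fin 2)) 1)) ∈ solidTorus := by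
  have hb : ‖(b : EuclideanSpace ℝ (Fin 2) × (sphere (0 : EuclideanSpace ℝ (Fin 2)) 1)).1‖ < 1 :=
    (mem_solidTorus_iff _).1 b.2
  rw [mem_solidTorus_iff]
  simp only
  rw [norm_smul, Real.norm_of_nonneg hc.le]
  calc c * ‖(b : EuclideanSpace ℝ (Fin 2) × (sphere (0 : EuclideanSpace ℝ (Fin 2)) 1)).1‖
      ≤ 1 * ‖(b : EuclideanSpace ℝ (Fin 2) × (sphere (0 : EuclideanSpace ℝ (Fin 2)) 1)).1‖ := by
        gcongr
    _ < 1 := by rw [one_mul]; exact hb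

end FriendsCarrierVk

open FriendsCarrierVk in
/-- **Helper `helper_friendsCarrier_Vk_rescale`** (registered piece of `helper_friendsCarrier_Vk`): the
presentation of `Y` as `M_k` surgered along `K₁` through the tube `νK` (solid torus `jB`, chart `jM`/`ψ` on
`W`, dual knot `μ₁ = jB(0, ·)`) is also a presentation through the fibre-rescaled tube `ν_c(u, w) = νK(u, c • w)`,
`0 < c ≤ 1`, with the rescaled solid torus `jB'(p, v) = jB(c • p, v)` and the same `jM`, `W`, `ψ`, `μ₁`.
[cite: Rolfsen1976, §9.F] -/
theorem helper_friendsCarrier_Vk_rescale : ∀ (k : ℕ) (K₁ : (sphere (0 : EuclideanSpace ℝ (Fin 2)) 1) → EuclideanSpace ℝ (Fin 4)) (Y : Type) [TopologicalSpace Y] [T2Space Y] [SecondCountableTopology Y] [ChartedSpace (EuclideanSpace ℝ (Fin 3)) Y] [IsManifold (𝓡 3) ∞ Y] (jB : solidTorus → Y) (μ₁ : C((sphere (0 : EuclideanSpace ℝ (Fin 2)) 1), Y)) (νK : (sphere (0 : EuclideanSpace ℝ (Fin 2)) 1) × EuclideanSpace ℝ (Fin 2) → EuclideanSpace ℝ (Fin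 4)) (jM : EuclideanSpace ℝ (Fin 4) → Y) (W : Set (EuclideanSpace ℝ (Fin 4))) (ψ : Y → EuclideanSpace ℝ (Fin 4)), (Manifold.IsSmoothEmbedding (𝓘(ℝ, EuclideanSpace ℝ (Fin 2)).prod (𝓡 1)) (𝓡 3) ∞ jB ∧ IsOpen (range jB) ∧ ContMDiff ((𝓡 1).prod 𝓘(ℝ, EuclideanSpace ℝ (Fin 2))) 𝓘(ℝ, EuclideanSpace ℝ (Fin 4)) ∞ νK ∧ Injective νK ∧ (∀ p, Injective (mfderiv ((𝓡 1).prod 𝓘(ℝ, EuclideanSpace ℝ (Fin 2))) 𝓘(ℝ, EuclideanSpace ℝ (Fin 4)) νK p)) ∧ (∀ p, νK p ∈ modelBoundary k) ∧ (∀ u : (sphere (0 : EuclideanSpace ℝ (Fin 2)) 1), νK (u, 0) = K₁ u) ∧ IsOpen W ∧ (∀ x ∈ modelBoundary k, x ∉ range K₁ → x ∈ W) ∧ ContMDiffOn 𝓘(ℝ, EuclideanSpace ℝ (Fin 4)) (𝓡 3) ∞ jM W ∧ IsOpen (jM '' {x : EuclideanSpace ℝ (Fin 4) | x ∈ modelBoundary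 k ∧ x ∉ range K₁}) ∧ ContMDiffOn (𝓡 3) 𝓘(ℝ, EuclideanSpace ℝ (Fin 4)) ∞ ψ (jM '' {x : EuclideanSpace ℝ (Fin 4) | x ∈ modelBoundary k ∧ x ∉ range K₁}) ∧ (∀ x ∈ modelBoundary k, x ∉ range K₁ → ψ (jM x) = x) ∧ jM '' {x : EuclideanSpace ℝ (Fin 4) | x ∈ modelBoundary k ∧ x ∉ range K₁} ∪ range jB = univ ∧ (∀ x ∈ modelBoundary k, x ∉ range K₁ → ∀ b : solidTorus, jM x = jB b ↔ ∃ (u : (sphere (0 : EuclideanSpace ℝ (Fin 2)) 1)) (t : ℝ), t ∈ Ioo (0 : ℝ) 1 ∧ b.1.1 = t • (u : EuclideanSpace ℝ (Fin 2)) ∧ x = νK (u, t • (b.1.2 : EuclideanSpace ℝ (Fin 2))))) → (∀ (v : (sphere (0 : EuclideanSpace ℝ (Fin 2)) 1)) (b : solidTorus), b.1 = (0, v) → μ₁ v = jB b) → ∀ c : ℝ, 0 < c → c ≤ 1 → ∃ jB' : solidTorus → Y, (Manifold.IsSmoothEmbedding (𝓘(ℝ, EuclideanSpace ℝ (Fin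 2)).prod (𝓡 1)) (𝓡 3) ∞ jB' ∧ IsOpen (range jB') ∧ ContMDiff ((𝓡 1).prod 𝓘(ℝ, EuclideanSpace ℝ (Fin 2))) 𝓘(ℝ, EuclideanSpace ℝ (Fin 4)) ∞ (fun q : (sphere (0 : EuclideanSpace ℝ (Fin 2)) 1) × EuclideanSpace ℝ (Fin 2) => νK (q.1, c • q.2)) ∧ Injective (fun q : (sphere (0 : EuclideanSpace ℝ (Fin 2)) 1) × EuclideanSpace ℝ (Fin 2) => νK (q.1, c • q.2)) ∧ (∀ p, Injective (mfderiv ((𝓡 1).prod 𝓘(ℝ, EuclideanSpace ℝ (Fin 2))) 𝓘(ℝ, EuclideanSpace ℝ (Fin 4)) (fun q : (sphere (0 : EuclideanSpace ℝ (Fin 2)) 1) × EuclideanSpace ℝ (Fin 2) => νK (q.1, c • q.2)) p)) ∧ (∀ p, (fun q : (sphere (0 : EuclideanSpace ℝ (Fin 2)) 1) × EuclideanSpace ℝ (Fin 2) => νK (q.1, c • q.2)) p ∈ modelBoundary k) ∧ (∀ u : (sphere (0 : EuclideanSpace ℝ (Fin 2)) 1), (fun q : (sphere (0 : EuclideanSpace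 ℝ (Fin 2)) 1) × EuclideanSpace ℝ (Fin 2) => νK (q.1, c • q.2)) (u, 0) = K₁ u) ∧ IsOpen W ∧ (∀ x ∈ modelBoundary k, x ∉ range K₁ → x ∈ W) ∧ ContMDiffOn 𝓘(ℝ, EuclideanSpace ℝ (Fin 4)) (𝓡 3) ∞ jM W ∧ IsOpen (jM '' {x : EuclideanSpace ℝ (Fin 4) | x ∈ modelBoundary k ∧ x ∉ range K₁}) ∧ ContMDiffOn (𝓡 3) 𝓘(ℝ, EuclideanSpace ℝ (Fin 4)) ∞ ψ (jM '' {x : EuclideanSpace ℝ (Fin 4) | x ∈ modelBoundary k ∧ x ∉ range K₁}) ∧ (∀ x ∈ modelBoundary k, x ∉ range K₁ → ψ (jM x) = x) ∧ jM '' {x : EuclideanSpace ℝ (Fin 4) | x ∈ modelBoundary k ∧ x ∉ range K₁} ∪ range jB' = univ ∧ (∀ x ∈ modelBoundary k, x ∉ range K₁ → ∀ b : solidTorus, jM x = jB' b ↔ ∃ (u : (sphere (0 : EuclideanSpace ℝ (Fin 2)) 1)) (t : ℝ), t ∈ Ioo (0 : ℝ) 1 ∧ b.1.1 = t • (u : EuclideanSpace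 ℝ (Fin 2)) ∧ x = (fun q : (sphere (0 : EuclideanSpace ℝ (Fin 2)) 1) × EuclideanSpace ℝ (Fin 2) => νK (q.1, c • q.2)) (u, t • (b.1.2 : EuclideanSpace ℝ (Fin 2))))) ∧ (∀ (v : (sphere (0 : EuclideanSpace ℝ (Fin 2)) 1)) (b : solidTorus), b.1 = (0, v) → μ₁ v = jB' b) := by
  intro k K₁ Y _ _ _ _ _ jB μ₁ νK jM W ψ ⟨h1, h2, h3, h4, h5, h6, h7, h8, h9, h10, h11, h12, h13, h14, h15⟩ hμ c hc hc1
  have hc0 : c ≠ 0 := hc.ne'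
  -- the fibre scaling of `ℝ² × 𝕊¹` as a homeomorphism
  set Tc : (EuclideanSpace ℝ (Fin 2) × (sphere (0 : EuclideanSpace ℝ (Fin 2)) 1)) ≃ₜ
      (EuclideanSpace ℝ (Fin 2) × (sphere (0 : EuclideanSpace ℝ (Fin 2)) 1)) :=
    (Homeomorph.smulOfNeZero c hc0).prodCongr (Homeomorph.refl _) with hTc
  have hTc_apply : ∀ q : EuclideanSpace ℝ (Fin 2) × (sphere (0 : EuclideanSpace ℝ (Fin 2)) 1), Tc q = (c • q.1, q.2) :=
    fun q => rfl
  -- the rescaled solid torus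
  set S : ↥solidTorus → ↥solidTorus := fun b =>
    ⟨((c • (b : EuclideanSpace ℝ (Fin 2) × (sphere (0 : EuclideanSpace ℝ (Fin 2)) 1)).1,
      (b : EuclideanSpace ℝ (Fin 2) × (sphere (0 : EuclideanSpace ℝ (Fin 2)) 1)).2) :
        EuclideanSpace ℝ (Fin 2) × (sphere (0 : EuclideanSpace ℝ (Fin 2)) 1)), smul_mem_solidTorus hc hc1 b⟩ with hS
  have hSval : ∀ b, ((S b : ↥solidTorus) : EuclideanSpace ℝ (Fin 2) × (sphere (0 : EuclideanSpace ℝ (Fin 2)) 1)) =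
      Tc b := fun b => rfl
  have hScomp : (Subtype.val ∘ S) = Tc ∘ Subtype.val := funext hSval
  set jB' : ↥solidTorus → Y := jB ∘ S with hjB'
  -- `S` is smooth, injective, open, with smooth inverse on its range
  have hSs : ContMDiff (𝓘(ℝ, EuclideanSpace ℝ (Fin 2)).prod (𝓡 1)) (𝓘(ℝ, EuclideanSpace ℝ (Fin 2)).prod (𝓡 1)) ∞ S := by
    rw [← ContMDiff.subtypeVal_comp_iff, hScomp]
    refine ContMDiff.comp ?_ contMDiff_subtype_val
    exact (((contDiff_const_smul c).contMDiff).comp contMDiff_fst).prodMk contMDiff_snd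
  have hSinj : Injective S := fun b b' h => by
    apply Subtype.ext
    apply (Tc).injective
    rw [← hSval, ← hSval, h]
  have hval : Topology.IsOpenEmbedding (Subtype.val : ↥solidTorus → EuclideanSpace ℝ (Fin 2) × (sphere (0 : EuclideanSpace ℝ (Fin 2)) 1)) :=
    solidTorus.2.isOpenEmbedding_subtypeVal
  have hSopen : IsOpenMap S := fun U hU => by
    rw [hval.isOpen_iff_image_isOpen, ← image_comp, hScomp, image_comp]
    exact (Tc).isOpenMap _ (hval.isOpenMap _ hU)
  classical
  set Sinv : ↥solidTorus → ↥solidTorus := fun b =>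
    if h : ((Tc).symm (b : EuclideanSpace ℝ (Fin 2) × (sphere (0 : EuclideanSpace ℝ (Fin 2)) 1))) ∈ solidTorus
    then ⟨_, h⟩ else b with hSinv
  have hleft : ∀ b, Sinv (S b) = b := fun b => by
    have hmem : (Tc).symm ((S b : ↥solidTorus) : EuclideanSpace ℝ (Fin 2) × (sphere (0 : EuclideanSpace ℝ (Fin 2)) 1)) ∈ solidTorus := by
      rw [hSval, Homeomorph.symm_apply_apply]; exact b.2
    simp only [hSinv, dif_pos hmem]
    apply Subtype.ext
    show (Tc).symm ((S b : ↥solidTorus) : EuclideanSpace ℝ (Fin 2) × (sphere (0 : EuclideanSpace ℝ (Fin 2)) 1)) = b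
    rw [hSval, Homeomorph.symm_apply_apply]
  have hrangeS : range S = {b : ↥solidTorus | (Tc).symm (b : EuclideanSpace ℝ (Fin 2) × (sphere (0 : EuclideanSpace ℝ (Fin 2)) 1)) ∈ solidTorus} := by
    ext b
    constructor
    · rintro ⟨b₀, rfl⟩
      show (Tc).symm ((S b₀ : ↥solidTorus) : _) ∈ solidTorus
      rw [hSval, Homeomorph.symm_apply_apply]; exact b₀.2
    · intro hb
      refine ⟨⟨_, hb⟩, Subtype.ext ?_⟩
      rw [hSval]
      exact (Tc).apply_symm_apply _
  have hrangeSo : IsOpen (range S) := by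
    rw [hrangeS]
    exact (solidTorus.2.preimage (Tc).symm.continuous).preimage continuous_subtype_val
  have hSinvs : ContMDiffOn (𝓘(ℝ, EuclideanSpace ℝ (Fin 2)).prod (𝓡 1)) (𝓘(ℝ, EuclideanSpace ℝ (Fin 2)).prod (𝓡 1)) ∞ Sinv (range S) := by
    intro b hb
    refine ContMDiffAt.contMDiffWithinAt ?_
    rw [← ContMDiffAt.subtypeVal_comp_iff]
    have hev : (Subtype.val ∘ Sinv) =ᶠ[𝓝 b] fun b => (Tc).symm (b : EuclideanSpace ℝ (Fin 2) × (sphere (0 : EuclideanSpace ℝ (Fin 2)) 1)) := by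
      filter_upwards [hrangeSo.mem_nhds hb] with b' hb'
      have hb'' : (Tc).symm (b' : EuclideanSpace ℝ (Fin 2) × (sphere (0 : EuclideanSpace ℝ (Fin 2)) 1)) ∈ solidTorus := by
        rw [hrangeS] at hb'; exact hb'
      simp only [comp_apply, hSinv]
      rw [dif_pos hb'']
    refine ContMDiffAt.congr_of_eventuallyEq ?_ hev
    have hsymm : ContMDiff (𝓘(ℝ, EuclideanSpace ℝ (Fin 2)).prod (𝓡 1)) (𝓘(ℝ, EuclideanSpace ℝ (Fin 2)).prod (𝓡 1)) ∞
        (fun q : EuclideanSpace ℝ (Fin 2) × (sphere (0 : EuclideanSpace ℝ (Fin 2)) 1) => (c⁻¹ • q.1, q.2)) :=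
      (((contDiff_const_smul c⁻¹).contMDiff).comp contMDiff_fst).prodMk contMDiff_snd
    have heq : (fun b : ↥solidTorus => (Tc).symm (b : EuclideanSpace ℝ (Fin 2) × (sphere (0 : EuclideanSpace ℝ (Fin 2)) 1))) =
        (fun q : EuclideanSpace ℝ (Fin 2) × (sphere (0 : EuclideanSpace ℝ (Fin 2)) 1) => (c⁻¹ • q.1, q.2)) ∘ Subtype.val := by
      funext b; rfl
    rw [heq]
    exact (hsymm.comp contMDiff_subtype_val).contMDiffAt
  -- `jB'` is a smooth embedding with open range
  obtain ⟨v₀⟩ : Nonempty (sphere (0 : EuclideanSpace ℝ (Fin 2)) 1) :=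
    (NormedSpace.sphere_nonempty.2 zero_le_one).to_subtype
  haveI : Nonempty ↥solidTorus := ⟨⟨((0 : EuclideanSpace ℝ (Fin 2)), v₀), by simp [mem_solidTorus_iff]⟩⟩
  have L : (EuclideanSpace ℝ (Fin 2) × EuclideanSpace ℝ (Fin 1)) ≃L[ℝ] EuclideanSpace ℝ (Fin 3) :=
    ContinuousLinearEquiv.ofFinrankEq (by simp)
  obtain ⟨hemb, hopen, -⟩ := Literature.Geometry.Manifold.isSmoothEmbedding_comp_of_inverse h1 h2 hSs hSinj hSopen
    hSinvs hleft L
  -- the rescaled tube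
  obtain ⟨hν1, hν2, hν3, hν4, hν5⟩ := rescaleTube h3 h4 h5 h6 h7 hc0
  -- a tube point off the zero section is off the knot
  have hoff : ∀ (u : (sphere (0 : EuclideanSpace ℝ (Fin 2)) 1)) (w : EuclideanSpace ℝ (Fin 2)), w ≠ 0 →
      νK (u, w) ∉ range K₁ := fun u w hw ⟨u', hu'⟩ => by
    rw [← h7 u'] at hu'
    have := congrArg Prod.snd (h4 hu')
    exact hw this.symm
  refine ⟨jB', ⟨hemb, hopen, hν1, hν2, hν3, hν4, hν5, h8, h9, h10, h11, h12, h13, ?_, ?_⟩, ?_⟩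
  · -- cover
    refine eq_univ_of_forall fun y => ?_
    rcases (h14 ▸ mem_univ y : y ∈ jM '' {x : EuclideanSpace ℝ (Fin 4) | x ∈ modelBoundary k ∧ x ∉ range K₁} ∪ range jB) with hy | ⟨b, rfl⟩
    · exact Or.inl hy
    · by_cases hb : (b : EuclideanSpace ℝ (Fin 2) × (sphere (0 : EuclideanSpace ℝ (Fin 2)) 1)).1 = 0
      · refine Or.inr ⟨b, ?_⟩
        show jB (S b) = jB b
        congr 1
        refine Subtype.ext (Prod.ext ?_ rfl)
        show c • (b : EuclideanSpace ℝ (Fin 2) × (sphere (0 : EuclideanSpace ℝ (Fin 2)) 1)).1 = _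
        rw [hb, smul_zero]
      · -- `jB (p, v) = jM (νK (p̂, ‖p‖ v))`
        set p : EuclideanSpace ℝ (Fin 2) := (b : EuclideanSpace ℝ (Fin 2) × (sphere (0 : EuclideanSpace ℝ (Fin 2)) 1)).1 with hp
        have hp0 : 0 < ‖p‖ := norm_pos_iff.2 hb
        have hp1 : ‖p‖ < 1 := (mem_solidTorus_iff _).1 b.2
        set u : (sphere (0 : EuclideanSpace ℝ (Fin 2)) 1) := ⟨‖p‖⁻¹ • p, by
          rw [mem_sphere_zero_iff_norm, norm_smul, norm_inv, norm_norm, inv_mul_cancel₀ hp0.ne']⟩ with hu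
        set x : EuclideanSpace ℝ (Fin 4) := νK (u, ‖p‖ • ((b : EuclideanSpace ℝ (Fin 2) × (sphere (0 : EuclideanSpace ℝ (Fin 2)) 1)).2 : EuclideanSpace ℝ (Fin 2))) with hx
        have hxM : x ∈ modelBoundary k := h6 _
        have hxK : x ∉ range K₁ := hoff _ _ (smul_ne_zero hp0.ne' (ne_zero_of_mem_unit_sphere _))
        have hrel : jM x = jB b := (h15 x hxM hxK b).2 ⟨u, ‖p‖, ⟨hp0, hp1⟩, by
          show p = ‖p‖ • (‖p‖⁻¹ • p)
          rw [smul_smul, mul_inv_cancel₀ hp0.ne', one_smul], rfl⟩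
        exact Or.inl ⟨x, ⟨hxM, hxK⟩, hrel⟩
  · -- gluing relation for `(ν_c, jB')`
    intro x hx hx' b
    show jM x = jB (S b) ↔ _
    rw [h15 x hx hx' (S b)]
    have hS1 : ((S b : ↥solidTorus) : EuclideanSpace ℝ (Fin 2) × (sphere (0 : EuclideanSpace ℝ (Fin 2)) 1)).1 =
        c • (b : EuclideanSpace ℝ (Fin 2) × (sphere (0 : EuclideanSpace ℝ (Fin 2)) 1)).1 := rfl
    have hS2 : ((S b : ↥solidTorus) : EuclideanSpace ℝ (Fin 2) × (sphere (0 : EuclideanSpace ℝ (Fin 2)) 1)).2 =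
        (b : EuclideanSpace ℝ (Fin 2) × (sphere (0 : EuclideanSpace ℝ (Fin 2)) 1)).2 := rfl
    have hb1 : ‖(b : EuclideanSpace ℝ (Fin 2) × (sphere (0 : EuclideanSpace ℝ (Fin 2)) 1)).1‖ < 1 := (mem_solidTorus_iff _).1 b.2
    rw [hS1, hS2]
    constructor
    · rintro ⟨u, t', ht', hbu, hxν⟩
      refine ⟨u, t' / c, ⟨div_pos ht'.1 hc, ?_⟩, ?_, ?_⟩
      · -- `t'/c = ‖b.1‖ < 1`
        have hnorm : ‖(b : EuclideanSpace ℝ (Fin 2) × (sphere (0 : EuclideanSpace ℝ (Fin 2)) 1)).1‖ = t' / c := by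
          have := congrArg (fun z : EuclideanSpace ℝ (Fin 2) => ‖z‖) hbu
          simp only [norm_smul, Real.norm_of_nonneg hc.le, Real.norm_of_nonneg ht'.1.le, norm_eq_of_mem_sphere, mul_one] at this
          field_simp
          linarith
        rw [← hnorm]; exact hb1
      · have := congrArg (fun z : EuclideanSpace ℝ (Fin 2) => c⁻¹ • z) hbu
        simp only [smul_smul, inv_mul_cancel₀ hc0, one_smul] at this
        rw [this, div_eq_inv_mul]
      · show x = νK (u, c • ((t' / c) • _))
        rw [hxν, smul_smul, mul_div_cancel₀ _ hc0]
    · rintro ⟨u, t, ht, hbu, hxν⟩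
      refine ⟨u, c * t, ⟨mul_pos hc ht.1, ?_⟩, ?_, ?_⟩
      · calc c * t ≤ 1 * t := by gcongr; exact ht.1.le
          _ < 1 := by rw [one_mul]; exact ht.2
      · rw [hbu, smul_smul]
      · rw [hxν]
        show νK (u, c • (t • _)) = _
        rw [smul_smul]
  · -- the dual knot
    intro v b hb
    show μ₁ v = jB (S b)
    refine hμ v (S b) ?_
    refine Prod.ext ?_ ?_
    · show c • (b : EuclideanSpace ℝ (Fin 2) × (sphere (0 : EuclideanSpace ℝ (Fin 2)) 1)).1 = 0
      rw [show (b : EuclideanSpace ℝ (Fin 2) × (sphere (0 : EuclideanSpace ℝ (Fin 2)) 1)).1 = 0 from congrArg Prod.fst hb, smul_zero]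
    · show (b : EuclideanSpace ℝ (Fin 2) × (sphere (0 : EuclideanSpace ℝ (Fin 2)) 1)).2 = v
      exact congrArg Prod.snd hb

end Summit.SmoothPoincare4.SmoothPoincare4.Theorems.DcrGap.MkFriends

end
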